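import Summits.CriticalPhenomena.PercolationContinuityZ3.Theorems.PercNearOneGluingNoHeavyLowerTailSunflowerTBernPack
import Summits.CriticalPhenomena.PercolationContinuityZ3.Theorems.PercNearOneGluingNoHeavyLowerTailSunflowerTBernStar
import Summits.CriticalPhenomena.PercolationContinuityZ3.Theorems.PercNearOneGluingNoHeavyLowerTailSunflowerTBernFloor
import HarnessLib

/-!
# `NoHeavyLowerTail` (crux stmt-CriticalPhenomena-4575), abstract sunflower cubic: T-BERN — the `TBern` certificate for
# every {hub, sub-dwarf pack, h-petal} family (`domOn_hub_pack_h`)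

Support file (seat `prim-ineq-prove-1` gen 64; `--supports stmt-CriticalPhenomena-4575`).  No `sorry`, no named facts.
Memo: run/shared/lean/prim/prim-ineq-prove-1/FINDING-PACK-prove1-g64.md §3.

The g63 reduction (memo FINDING-CONVEX §1–§2) leaves, as the heart of `TBern s b β V`, the floor-free merge-free families
{ONE arbitrary petal `P` (the hub), a PACK of sub-dwarfs `(u_j, β, u_j)` (`b ≤ u_j ≤ β`; floors included), ONE h-petal
`(b, vv_h, b)`}.  **`domOn_hub_pack_h`**: every admissible such family admits the certificate `DomOn s b β V`
(`…SunflowerTBernFloor`), for all `0 < b ≤ β ≤ 1`, `β ≤ V`, `0 ≤ s ≤ 1`, every pack size.  Proof = the sequential scheme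
in normalised coordinates: the hub as a singleton, the pack absorbed by **`zone_extend_flex`** (the exact absorption of
`zone_extend_exact` while the state stays `u`-heavy, `S ≥ 1`; at the first petal that would flip it, the step
`A'' = max(exact, A'α_j) ≤ G''`, and aligned steps afterwards), then the h-petal by `coefDom_insert_h_of_star`, whose
condition ★ is the aligned triviality when the state ended `γ`-heavy and otherwise `star_of_hc` + **`hc_pack`**
(`…SunflowerTBernPack`: (HC) for every hub and every tight pack); finally `domOn_of_normalised`.
-/

noncomputable section

namespace Summit.CriticalPhenomena.PercolationContinuityZ3.Theorems.SunflowerPartition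

namespace SafeCalc

namespace LinkedCurrency

open Finset Polynomial

variable {ι : Type*} [DecidableEq ι]

/-! ## The flexible absorption of γ-heavy x-type petals -/

/-- A small inequality for the switching step: `S·α ≤ γ` when `S ≤ 1 + (γ−α)/γ`, `0 ≤ α ≤ γ`, `0 < γ`. [this work] -/
theorem switch_le {S α γ : ℝ} (hγ : 0 < γ) (hα : 0 ≤ α) (hS : S ≤ 1 + (γ - α) / γ) : S * α ≤ γ := by
  have h1 : S * γ ≤ γ + (γ - α) := by
    have := mul_le_mul_of_nonneg_right hS hγ.le
    rwa [add_mul, one_mul, div_mul_cancel₀ _ hγ.ne'] at this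
  nlinarith [mul_le_mul_of_nonneg_right h1 hα, sq_nonneg (γ - α), mul_nonneg hγ.le hα]

set_option maxHeartbeats 400000 in
/-- **Flexible absorption.**  Starting from a certificate with state `(A, G)` (`0 ≤ A ≤ α(X₀)`, `G ≥ 1`) for `t₀`, the
γ-heavy petals `W` (`α_j ≤ γ_j ≤ x_j`) are absorbed with `G` kept exact (`G·∏γ_j`) and SOME `A'` with `0 ≤ A' ≤ α(X₀∏x_j)`
such that EITHER the state is γ-heavy (`A' ≤ G∏γ_j`) OR it is the exact state of `zone_extend_exact`
(`A' = (G∏γ_j)(A/G − Σd_j)` with `A/G − Σd_j ≥ 1`). [this work] -/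
theorem zone_extend_flex {κ : ℝ} (hκ0 : 0 ≤ κ) (hκ1 : κ ≤ 1) (x γ : ι → ℝ) (t₀ : Finset ι) (ht₀ : t₀.Nonempty)
    {X₀ A G : ℝ} (hX₀ : 1 ≤ X₀) (hG : 1 ≤ G) (hA : A ≤ 1 + κ * (X₀ - 1)) (hA0 : 0 ≤ A)
    (hdom : CoefDom (prodPoly t₀ (fun j => 1 + κ * (x j - 1)) γ)
      ((C 1 * X + C 1) ^ (t₀.card - 1) * (C A * X + C G)))
    (W : Finset ι) (hW : Disjoint t₀ W) (hx : ∀ j ∈ W, 1 ≤ x j) (hγx : ∀ j ∈ W, γ j ≤ x j)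
    (hg : ∀ j ∈ W, 1 + κ * (x j - 1) ≤ γ j) :
    ∃ A' : ℝ, CoefDom (prodPoly (t₀ ∪ W) (fun j => 1 + κ * (x j - 1)) γ)
        ((C 1 * X + C 1) ^ ((t₀ ∪ W).card - 1) * (C A' * X + C (G * ∏ j ∈ W, γ j))) ∧
      A' ≤ 1 + κ * (X₀ * ∏ j ∈ W, x j - 1) ∧ 0 ≤ A' ∧
      (A' ≤ G * ∏ j ∈ W, γ j ∨
        (A' = (G * ∏ j ∈ W, γ j) * (A / G - ∑ j ∈ W, (γ j - (1 + κ * (x j - 1))) / γ j) ∧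
          1 ≤ A / G - ∑ j ∈ W, (γ j - (1 + κ * (x j - 1))) / γ j)) := by
  classical
  have hGpos : 0 < G := zero_lt_one.trans_le hG
  induction W using Finset.induction_on with
  | empty =>
    refine ⟨A, by simpa using hdom, by simpa using hA, hA0, ?_⟩
    by_cases hAG : A ≤ G
    · left; simpa using hAG
    · right
      refine ⟨by simp [mul_div_cancel₀ A hGpos.ne'], ?_⟩
      simp only [sum_empty, sub_zero]
      rw [le_div_iff₀ hGpos]; linarith
  | @insert j W hjW ih =>
    have hdis : Disjoint t₀ W := Disjoint.mono_right (subset_insert j W) hW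
    have hjt : j ∉ t₀ := fun h => (disjoint_left.1 hW) h (mem_insert_self j W)
    have hj : j ∉ t₀ ∪ W := by rw [mem_union, not_or]; exact ⟨hjt, hjW⟩
    have hxj : 1 ≤ x j := hx j (mem_insert_self j W)
    have hγxj : γ j ≤ x j := hγx j (mem_insert_self j W)
    have hgj : 1 + κ * (x j - 1) ≤ γ j := hg j (mem_insert_self j W)
    have hαj1 : 1 ≤ 1 + κ * (x j - 1) := by nlinarith
    have hαj0 : 0 ≤ 1 + κ * (x j - 1) := zero_le_one.trans hαj1
    have hγj1 : 1 ≤ γ j := hαj1.trans hgj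
    have hγj0 : 0 < γ j := zero_lt_one.trans_le hγj1
    obtain ⟨A', key, hA'le, hA'0, hdisj⟩ := ih hdis (fun i hi => hx i (mem_insert_of_mem hi))
      (fun i hi => hγx i (mem_insert_of_mem hi)) (fun i hi => hg i (mem_insert_of_mem hi))
    set GW := G * ∏ i ∈ W, γ i with hGWd
    set XW := X₀ * ∏ i ∈ W, x i with hXWd
    set SW := A / G - ∑ i ∈ W, (γ i - (1 + κ * (x i - 1))) / γ i with hSWd
    have hGW1 : 1 ≤ GW := by
      have : 1 ≤ ∏ i ∈ W, γ i := Pendant.one_le_prod_of_one_le W fun i hi =>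
        (show (1:ℝ) ≤ 1 + κ * (x i - 1) by nlinarith [hx i (mem_insert_of_mem hi)]).trans (hg i (mem_insert_of_mem hi))
      nlinarith
    have hXW1 : 1 ≤ XW := by
      have : 1 ≤ ∏ i ∈ W, x i := Pendant.one_le_prod_of_one_le W fun i hi => hx i (mem_insert_of_mem hi)
      nlinarith
    have hGW0 : 0 ≤ GW := zero_le_one.trans hGW1
    have hne : (t₀ ∪ W).Nonempty := ht₀.mono subset_union_left
    have hprodγ : G * ∏ i ∈ insert j W, γ i = GW * γ j := by rw [prod_insert hjW]; ring
    have hprodx : X₀ * ∏ i ∈ insert j W, x i = XW * x j := by rw [prod_insert hjW]; ring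
    have hsum : A / G - ∑ i ∈ insert j W, (γ i - (1 + κ * (x i - 1))) / γ i =
        SW - (γ j - (1 + κ * (x j - 1))) / γ j := by rw [sum_insert hjW]; ring
    rw [union_insert, hprodγ, hprodx, hsum]
    -- bounds for the two candidate new `A`-values
    have hone := alpha_mul_le hκ0 hκ1 hXW1 hxj
    have hal : A' * (1 + κ * (x j - 1)) ≤ 1 + κ * (XW * x j - 1) :=
      (mul_le_mul_of_nonneg_right hA'le hαj0).trans hone
    have hex : A' * γ j - GW * (γ j - (1 + κ * (x j - 1))) ≤ 1 + κ * (XW * x j - 1) := by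
      have h1 := xstep_le hκ0 hXW1 hGW1 hgj hγxj
      have h2 : A' * γ j ≤ (1 + κ * (XW - 1)) * γ j := mul_le_mul_of_nonneg_right hA'le hγj0.le
      nlinarith
    rcases hdisj with hleft | ⟨hA'eq, hS1⟩
    · -- γ-heavy state: aligned step
      refine ⟨A' * (1 + κ * (x j - 1)), ?_, hal, mul_nonneg hA'0 hαj0, Or.inl ?_⟩
      · refine coefDom_prodPoly_insert hj hne zero_le_one zero_le_one hαj0 hγj0.le key ?_ ?_ ?_
        · rw [one_mul]
        · rw [one_mul]
        · nlinarith [mul_nonneg (sub_nonneg.2 hleft) (sub_nonneg.2 hgj)]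
      · exact mul_le_mul hleft hgj hαj0 hGW0
    · have hAG : GW ≤ A' := by rw [hA'eq]; nlinarith
      by_cases hS : 1 ≤ SW - (γ j - (1 + κ * (x j - 1))) / γ j
      · -- exact step, the state stays `u`-heavy
        refine ⟨(GW * γ j) * (SW - (γ j - (1 + κ * (x j - 1))) / γ j), ?_, ?_, ?_, Or.inr ⟨rfl, hS⟩⟩
        · have hnewA : (GW * γ j) * (SW - (γ j - (1 + κ * (x j - 1))) / γ j) =
              A' * γ j - GW * (γ j - (1 + κ * (x j - 1))) := by rw [hA'eq]; field_simp
          rw [hnewA]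
          refine coefDom_prodPoly_insert hj hne zero_le_one zero_le_one hαj0 hγj0.le key ?_ ?_ ?_
          · nlinarith [mul_nonneg (sub_nonneg.2 hAG) (sub_nonneg.2 hgj)]
          · rw [one_mul]
          · nlinarith
        · have hnewA : (GW * γ j) * (SW - (γ j - (1 + κ * (x j - 1))) / γ j) =
              A' * γ j - GW * (γ j - (1 + κ * (x j - 1))) := by rw [hA'eq]; field_simp
          rw [hnewA]; exact hex
        · exact mul_nonneg (mul_nonneg hGW0 hγj0.le) (by linarith)
      · -- switching step: `A'' = max(exact, aligned) ≤ G''`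
        push Not at hS
        set Aex := A' * γ j - GW * (γ j - (1 + κ * (x j - 1))) with hAex
        refine ⟨max Aex (A' * (1 + κ * (x j - 1))), ?_, max_le hex hal,
          (mul_nonneg hA'0 hαj0).trans (le_max_right _ _), Or.inl (max_le ?_ ?_)⟩
        · refine coefDom_prodPoly_insert hj hne zero_le_one zero_le_one hαj0 hγj0.le key ?_ ?_ ?_
          · rw [one_mul]; exact le_max_right _ _
          · rw [one_mul]
          · have := le_max_left Aex (A' * (1 + κ * (x j - 1)))
            rw [hAex] at this; linarith
        · -- exact branch: GW γ_j (SW − d_j) ≤ GW γ_j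
          have e : Aex = (GW * γ j) * (SW - (γ j - (1 + κ * (x j - 1))) / γ j) := by
            rw [hAex, hA'eq]; field_simp
          rw [e]
          have : (GW * γ j) * (SW - (γ j - (1 + κ * (x j - 1))) / γ j) ≤ (GW * γ j) * 1 :=
            mul_le_mul_of_nonneg_left hS.le (mul_nonneg hGW0 hγj0.le)
          linarith
        · -- aligned branch: GW·SW·α_j ≤ GW γ_j
          rw [hA'eq, mul_assoc]
          refine mul_le_mul_of_nonneg_left ?_ hGW0
          exact switch_le hγj0 hαj0 (by linarith)

/-! ## The dictionary model → normalised coordinates (pure field identities) -/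

/-- `μ = 1 − λ`: `sβ/a₀ = 1 − (1−s)b/a₀`, `a₀ = (1−s)b + sβ ≠ 0`. [this work] -/
theorem norm_mu_eq {s b β : ℝ} (ha₀ : (1 - s) * b + s * β ≠ 0) :
    s * β / ((1 - s) * b + s * β) = 1 - (1 - s) * b / ((1 - s) * b + s * β) := by
  field_simp; ring

/-- `ᾱ = (1−κ) + K`: `1/A₀ = (1 − (1−s)b/A₀) + (1−s)/A₀`, `A₀ = s + (1−s)b ≠ 0`. [this work] -/
theorem norm_abar_eq {s b : ℝ} (hA₀ : s + (1 - s) * b ≠ 0) :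
    1 / (s + (1 - s) * b) = (1 - (1 - s) * b / (s + (1 - s) * b)) + (1 - s) / (s + (1 - s) * b) := by
  field_simp; ring

/-- `γ_D = λD + μ = β/a₀`. [this work] -/
theorem norm_gammaD_eq {s b β : ℝ} (hb : b ≠ 0) (ha₀ : (1 - s) * b + s * β ≠ 0) :
    (1 - s) * b / ((1 - s) * b + s * β) * (β / b) + s * β / ((1 - s) * b + s * β) = β / ((1 - s) * b + s * β) := by
  field_simp; ring

/-- (I1) `μᾱ = (1−κ)γ_D` in the model. [this work] -/
theorem norm_I_eq {s b β : ℝ} (hA₀ : s + (1 - s) * b ≠ 0) (ha₀ : (1 - s) * b + s * β ≠ 0) :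
    s * β / ((1 - s) * b + s * β) * (1 / (s + (1 - s) * b)) =
      (1 - (1 - s) * b / (s + (1 - s) * b)) * (β / ((1 - s) * b + s * β)) := by
  field_simp; ring

/-- `A_j/A₀ = 1 + κ(x_j − 1)` with `x_j = u_j/b`. [this work] -/
theorem norm_alpha_eq {s b u : ℝ} (hb : b ≠ 0) (hA₀ : s + (1 - s) * b ≠ 0) :
    (s + (1 - s) * u) / (s + (1 - s) * b) = 1 + (1 - s) * b / (s + (1 - s) * b) * (u / b - 1) := by
  field_simp; ring

/-- `g_j/a₀ = λ(m_j/b) + μ(vv_j/β)`. [this work] -/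
theorem norm_gamma_eq {s b β mm v : ℝ} (hb : b ≠ 0) (hβ : β ≠ 0) (ha₀ : (1 - s) * b + s * β ≠ 0) :
    ((1 - s) * mm + s * v) / ((1 - s) * b + s * β) =
      (1 - s) * b / ((1 - s) * b + s * β) * (mm / b) + s * β / ((1 - s) * b + s * β) * (v / β) := by
  field_simp

/-! ## The certificate for {hub, sub-dwarf pack, h-petal} families -/

/-- **The `TBern` certificate for every admissible {hub, sub-dwarf pack, h-petal} family.**  Parameters
`0 < b ≤ β ≤ 1`, `0 ≤ s ≤ 1` (`β ≤ V` is implied by admissibility); the family on `insert h (insert P Q)` is admissible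
(`AdmissibleOn`), the pack petals `j ∈ Q` have `vv_j = β`, `m_j = u_j` (sub-dwarfs and floors), the h-petal has
`u_h = m_h = b`; `P` is arbitrary.  Then `DomOn s b β V (insert h (insert P Q)) u vv m`. [this work] -/
theorem domOn_hub_pack_h {s b β V : ℝ} (hb : 0 < b) (hbβ : b ≤ β) (hβ1 : β ≤ 1) (hs0 : 0 ≤ s) (hs1 : s ≤ 1)
    {Q : Finset ι} {P h : ι} (hPQ : P ∉ Q) (hhQ : h ∉ Q) (hhP : h ≠ P) {u vv m : ι → ℝ}
    (hadm : AdmissibleOn s b β V (insert h (insert P Q)) u vv m)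
    (hpack : ∀ j ∈ Q, vv j = β ∧ m j = u j) (huh : u h = b) (hmh : m h = b) :
    DomOn s b β V (insert h (insert P Q)) u vv m := by
  obtain ⟨hub, -, hvβ, -, hmb, hmu, hmv, hpu, hpv, hpg⟩ := hadm
  have hs' : 0 ≤ 1 - s := sub_nonneg.2 hs1
  have hβ : 0 < β := hb.trans_le hbβ
  have hA₀ : 0 < s + (1 - s) * b := by
    have : 0 ≤ s * (1 - b) := mul_nonneg hs0 (by linarith)
    nlinarith
  have ha₀ : 0 < (1 - s) * b + s * β := by
    have : 0 ≤ s * (β - b) := mul_nonneg hs0 (sub_nonneg.2 hbβ)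
    nlinarith
  have hA₀ne := hA₀.ne'
  have ha₀ne := ha₀.ne'
  have hbne := hb.ne'
  have hβne := hβ.ne'
  -- membership facts
  have hht : h ∉ insert P Q := by rw [mem_insert, not_or]; exact ⟨hhP, hhQ⟩
  have hP : P ∈ insert h (insert P Q) := mem_insert_of_mem (mem_insert_self P Q)
  have hh : h ∈ insert h (insert P Q) := mem_insert_self h _
  have hQ : ∀ j ∈ Q, j ∈ insert h (insert P Q) := fun j hj => mem_insert_of_mem (mem_insert_of_mem hj)
  have hcard : (insert h (insert P Q)).card = Q.card + 2 := by
    rw [card_insert_of_notMem hht, card_insert_of_notMem hPQ]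
  rw [hcard, show Q.card + 2 - 1 = Q.card + 1 by omega] at hpu hpv hpg
  rw [prod_insert hht, prod_insert hPQ] at hpu hpv hpg
  -- normalised parameters
  set A₀ := s + (1 - s) * b with hA₀d
  set a₀ := (1 - s) * b + s * β with ha₀d
  set κ := (1 - s) * b / A₀ with hκ
  set lam := (1 - s) * b / a₀ with hlam
  set μ := s * β / a₀ with hμd
  set D := β / b with hDd
  set K := (1 - s) / A₀ with hKd
  have hκ0 : 0 ≤ κ := div_nonneg (mul_nonneg hs' hb.le) hA₀.le
  have hκl : κ ≤ lam := by
    rw [hκ, hlam]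
    refine div_le_div_of_nonneg_left (mul_nonneg hs' hb.le) ha₀ ?_
    rw [ha₀d, hA₀d]; linarith [mul_le_mul_of_nonneg_left hβ1 hs0]
  have hl1 : lam ≤ 1 := by rw [hlam, div_le_one ha₀, ha₀d]; linarith [mul_nonneg hs0 hβ.le]
  have hl0 : 0 ≤ lam := hκ0.trans hκl
  have hμ : μ = 1 - lam := norm_mu_eq ha₀ne
  have hμ0 : 0 ≤ μ := div_nonneg (mul_nonneg hs0 hβ.le) ha₀.le
  have hD : 1 ≤ D := by rw [hDd, one_le_div hb]; exact hbβ
  have hK0 : 0 ≤ K := div_nonneg hs' hA₀.le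
  have habar : 1 / A₀ = (1 - κ) + K := norm_abar_eq hA₀ne
  have hγD : lam * D + μ = β / a₀ := norm_gammaD_eq hbne ha₀ne
  have hI : μ * (1 / A₀) = (1 - κ) * (lam * D + μ) := by rw [hγD]; exact norm_I_eq hA₀ne ha₀ne
  have hγD0 : 0 < lam * D + μ := by rw [hγD]; exact div_pos hβ ha₀
  -- normalised functions
  set xf : ι → ℝ := fun j => u j / b with hxf
  set cf : ι → ℝ := fun j => ((1 - s) * m j + s * vv j) / a₀ with hcf
  set ξ : ι → ℝ := fun j => u j / b - 1 with hξ
  have hα : ∀ j, (s + (1 - s) * u j) / A₀ = 1 + κ * (xf j - 1) := fun j => norm_alpha_eq hbne hA₀ne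
  have hcf_eq : ∀ j, cf j = lam * (m j / b) + μ * (vv j / β) := fun j => norm_gamma_eq hbne hβne ha₀ne
  have hxξ : ∀ j, xf j = 1 + ξ j := fun j => by simp only [hxf, hξ]; ring
  -- pack data
  have hξ0 : ∀ j ∈ Q, 0 ≤ ξ j := fun j hj => by
    have h1 : 1 ≤ u j / b := by rw [one_le_div hb]; exact hub j (hQ j hj)
    simp only [hξ]; linarith
  have hξD : ∀ j ∈ Q, ξ j ≤ D - 1 := fun j hj => by
    have h1 : u j ≤ β := by rw [← (hpack j hj).2, ← (hpack j hj).1]; exact hmv j (hQ j hj)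
    have h2 : u j / b ≤ β / b := div_le_div_of_nonneg_right h1 hb.le
    simp only [hξ, hDd]; linarith
  have hcfQ : ∀ j ∈ Q, cf j = 1 + lam * ξ j := fun j hj => by
    rw [hcf_eq, (hpack j hj).2, (hpack j hj).1, div_self hβne, hμ]; simp only [hξ]; ring
  -- hub data
  have hxP1 : 1 ≤ u P / b := by rw [one_le_div hb]; exact hub P hP
  have hz1 : 1 ≤ vv P / β := by rw [one_le_div hβ]; exact hvβ P hP
  have hw1 : 1 ≤ m P / b := by rw [one_le_div hb]; exact hmb P hP
  have hwx : m P / b ≤ u P / b := div_le_div_of_nonneg_right (hmu P hP) hb.le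
  have hwD : m P / b ≤ D * (vv P / β) := by
    rw [hDd, div_mul_div_comm, div_le_div_iff₀ hb (mul_pos hb hβ)]
    have := mul_le_mul_of_nonneg_right (hmv P hP) (mul_pos hb hβ).le
    linarith
  have hγP : cf P = lam * (m P / b) + μ * (vv P / β) := hcf_eq P
  have hγP1 : 1 ≤ cf P := by
    have h1 : lam * 1 ≤ lam * (m P / b) := mul_le_mul_of_nonneg_left hw1 hl0
    have h2 : μ * 1 ≤ μ * (vv P / β) := mul_le_mul_of_nonneg_left hz1 hμ0
    rw [hγP]; rw [hμ] at h2 ⊢; linarith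
  have hγP0 : 0 < cf P := by linarith
  -- h-petal data
  have hxh : xf h = 1 := by simp only [hxf, huh, div_self hbne]
  have hah : 1 + κ * (xf h - 1) = 1 := by rw [hxh]; ring
  have hζ0 : 0 ≤ vv h / β - 1 := by rw [sub_nonneg, one_le_div hβ]; exact hvβ h hh
  have hch : cf h = 1 + μ * (vv h / β - 1) := by rw [hcf_eq, hmh, div_self hbne, hμ]; ring
  have hch0 : 0 ≤ cf h := by rw [hch]; have := mul_nonneg hμ0 hζ0; linarith
  -- STEP A: hub singleton + flexible absorption of the pack
  have hbase : CoefDom (prodPoly {P} (fun j => 1 + κ * (xf j - 1)) cf)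
      ((C 1 * X + C 1) ^ (({P} : Finset ι).card - 1) * (C (1 + κ * (u P / b - 1)) * X + C (cf P))) :=
    coefDom_prodPoly_singleton le_rfl le_rfl
  have hαP0 : 0 ≤ 1 + κ * (u P / b - 1) := by
    have := mul_nonneg hκ0 (sub_nonneg.2 hxP1); linarith
  have hQx : ∀ j ∈ Q, 1 ≤ xf j := fun j hj => by rw [hxξ]; linarith [hξ0 j hj]
  have hQγx : ∀ j ∈ Q, cf j ≤ xf j := fun j hj => by
    rw [hcfQ j hj, hxξ]
    have := mul_le_mul_of_nonneg_right hl1 (hξ0 j hj)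
    linarith
  have hQg : ∀ j ∈ Q, 1 + κ * (xf j - 1) ≤ cf j := fun j hj => by
    rw [hcfQ j hj, hxξ, add_sub_cancel_left]
    have := mul_le_mul_of_nonneg_right hκl (hξ0 j hj)
    linarith
  obtain ⟨A', hdomPQ, hA'le, -, hdisj⟩ := zone_extend_flex (X₀ := u P / b) (A := 1 + κ * (u P / b - 1))
    (G := cf P) hκ0 (hκl.trans hl1) xf cf {P} (singleton_nonempty P) hxP1 hγP1 le_rfl hαP0 hbase Q
    (disjoint_singleton_left.2 hPQ) hQx hQγx hQg
  rw [← insert_eq] at hdomPQ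
  -- the pack quantities of `…SunflowerTBernPackStep`
  have hpackG : packG lam Q ξ = ∏ j ∈ Q, cf j := prod_congr rfl fun j hj => (hcfQ j hj).symm
  have hpackS : packS κ lam Q ξ = ∑ j ∈ Q, (cf j - (1 + κ * (xf j - 1))) / cf j := by
    refine sum_congr rfl fun j hj => ?_
    rw [hcfQ j hj, hxξ, add_sub_cancel_left]; ring
  have hprodX : ∏ j ∈ Q, (1 + ξ j) = ∏ j ∈ Q, xf j := prod_congr rfl fun j _ => (hxξ j).symm
  have hGQ1 : 1 ≤ cf P * ∏ j ∈ Q, cf j := by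
    have : 1 ≤ ∏ j ∈ Q, cf j := by rw [← hpackG]; exact one_le_packG hl0 Q hξ0
    exact one_le_mul_of_one_le_of_one_le hγP1 this
  -- BUDGETS.  u-budget ⟹ u_P ∏_Q u_j ≤ b^|Q| ⟹ κ x_P ∏(1+ξ_j) ≤ K and x_P ∏ x_j ≤ 1/b
  rw [huh, mul_comm b, pow_succ] at hpu
  have hubud : u P * ∏ j ∈ Q, u j ≤ b ^ Q.card := le_of_mul_le_mul_right hpu hb
  have hXprod : u P / b * ∏ j ∈ Q, xf j = (u P * ∏ j ∈ Q, u j) / (b * b ^ Q.card) := by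
    simp only [hxf]
    rw [prod_div_distrib, prod_const, div_mul_div_comm]
  have hXle : u P / b * ∏ j ∈ Q, xf j ≤ 1 / b := by
    rw [hXprod, div_le_div_iff₀ (mul_pos hb (pow_pos hb _)) hb]
    calc (u P * ∏ j ∈ Q, u j) * b ≤ b ^ Q.card * b := mul_le_mul_of_nonneg_right hubud hb.le
      _ = 1 * (b * b ^ Q.card) := by ring
  have hbud : κ * (u P / b) * ∏ j ∈ Q, (1 + ξ j) ≤ K := by
    rw [hprodX, mul_assoc, hκ, hKd, div_mul_eq_mul_div, div_le_div_iff_of_pos_right hA₀]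
    have h1 := mul_le_mul_of_nonneg_left hXle (mul_nonneg hs' hb.le)
    have e : (1 - s) * b * (1 / b) = 1 - s := by field_simp
    linarith
  have hA'abar : A' ≤ 1 / A₀ := by
    refine hA'le.trans ?_
    rw [habar, hKd, hκ]
    have h1 : (1 - s) * b / A₀ * (u P / b * ∏ j ∈ Q, xf j - 1) ≤ (1 - s) * b / A₀ * (1 / b - 1) :=
      mul_le_mul_of_nonneg_left (by linarith) hκ0
    have e : (1 - s) * b / A₀ * (1 / b - 1) = (1 - s) / A₀ - (1 - s) * b / A₀ := by field_simp
    linarith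
  -- g-budget ⟹ GQ · cf h ≤ V/a₀
  have hgbud : cf P * (∏ j ∈ Q, cf j) * cf h ≤ V / a₀ := by
    simp only [hcf]
    rw [prod_div_distrib, prod_const, div_mul_div_comm, div_mul_div_comm,
      div_le_div_iff₀ (mul_pos (mul_pos ha₀ (pow_pos ha₀ _)) ha₀) ha₀]
    calc ((1 - s) * m P + s * vv P) * (∏ j ∈ Q, ((1 - s) * m j + s * vv j)) * ((1 - s) * m h + s * vv h) * a₀
        = ((1 - s) * m h + s * vv h) * (((1 - s) * m P + s * vv P) * ∏ j ∈ Q, ((1 - s) * m j + s * vv j)) * a₀ := by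
          ring
      _ ≤ a₀ ^ (Q.card + 1) * V * a₀ := mul_le_mul_of_nonneg_right hpg ha₀.le
      _ = V * (a₀ * a₀ ^ Q.card * a₀) := by ring
  have hgbud' : cf P * (∏ j ∈ Q, cf j) * (1 + μ * (vv h / β - 1)) ≤ V / a₀ := by rw [← hch]; exact hgbud
  -- vv-budget ⟹ γ_D z_P z_h ≤ V/a₀
  have hzbud : (lam * D + μ) * (vv P / β) * (1 + (vv h / β - 1)) ≤ V / a₀ := by
    rw [prod_congr rfl fun j hj => (hpack j hj).1, prod_const] at hpv
    have h1 : vv h * vv P ≤ β * V := by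
      have h2 : vv h * vv P * β ^ Q.card ≤ β * V * β ^ Q.card := by
        have e1 : vv h * vv P * β ^ Q.card = vv h * (vv P * β ^ Q.card) := by ring
        have e2 : β * V * β ^ Q.card = β ^ (Q.card + 1) * V := by ring
        rw [e1, e2]; exact hpv
      exact le_of_mul_le_mul_right h2 (pow_pos hβ _)
    have e3 : β / a₀ * (vv P / β) * (vv h / β) = (vv h * vv P) / (a₀ * β) := by
      field_simp
    rw [hγD, add_sub_cancel, e3, div_le_div_iff₀ (mul_pos ha₀ hβ) ha₀]
    calc vv h * vv P * a₀ ≤ β * V * a₀ := mul_le_mul_of_nonneg_right h1 ha₀.le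
      _ = V * (a₀ * β) := by ring
  -- STEP B: the h-petal (★)
  have hstar : A' * cf h + cf P * ∏ j ∈ Q, cf j ≤ 1 / A₀ + V / a₀ := by
    rw [hch] at ⊢
    rcases hdisj with hleft | ⟨hA'eq, -⟩
    · -- γ-heavy final state: aligned triviality
      have : A' * (μ * (vv h / β - 1)) ≤ cf P * (∏ j ∈ Q, cf j) * (μ * (vv h / β - 1)) :=
        mul_le_mul_of_nonneg_right hleft (mul_nonneg hμ0 hζ0)
      linarith
    · -- the exact state: ★ from (HC) via `hc_pack`
      have hgz : 0 < (lam * D + μ) * (vv P / β) := mul_pos hγD0 (by linarith)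
      have hIle : 1 / A₀ * μ ≤ (lam * D + μ) * (vv P / β) := by
        have h2 : (1 - κ) * (lam * D + μ) ≤ 1 * (lam * D + μ) :=
          mul_le_mul_of_nonneg_right (by linarith) hγD0.le
        rw [mul_comm, hI]
        calc (1 - κ) * (lam * D + μ) ≤ 1 * (lam * D + μ) := h2
          _ = (lam * D + μ) * 1 := by ring
          _ ≤ (lam * D + μ) * (vv P / β) := mul_le_mul_of_nonneg_left hz1 hγD0.le
      refine star_of_hc hμ0 hζ0 hgz hA'abar hgbud' hzbud hIle ?_
      have hGQeq : cf P * ∏ j ∈ Q, cf j = (lam * (m P / b) + μ * (vv P / β)) * packG lam Q ξ := by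
        rw [hpackG, hγP]
      have hA'eq2 : A' = packG lam Q ξ * (1 + κ * (u P / b - 1)) -
          cf P * (∏ j ∈ Q, cf j) * packS κ lam Q ξ := by
        rw [hA'eq, hpackS, mul_sub, hpackG]
        congr 1
        rw [mul_comm (cf P) _, mul_assoc, mul_div_cancel₀ _ hγP0.ne']
      exact hc_pack hκ0 hκl hl1 hμ hD hK0 habar hI Q hξ0 hξD hz1 hw1 hwx hwD hbud hGQeq hA'eq2 hA'abar
  have hfull := coefDom_insert_h_of_star (a := fun j => 1 + κ * (xf j - 1)) (c := cf)
    (insert_nonempty P Q) hht hdomPQ hah hch0 hA'abar hgbud hstar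
  -- STEP C: back to `DomOn`
  refine domOn_of_normalised hA₀ ha₀ ⟨h, hh⟩ ?_
  have e1 : (fun j => (s + (1 - s) * u j) / A₀) = fun j => 1 + κ * (xf j - 1) := funext hα
  rw [e1]
  exact hfull

end LinkedCurrency

end SafeCalc

end Summit.CriticalPhenomena.PercolationContinuityZ3.Theorems.SunflowerPartition
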